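import Summits.ResolutionOfSingularities.ResolutionOfSingularities.Theorems.RadicialJungCleanModelsAbsoluteDifferentialsLocallyFree
import Summits.ResolutionOfSingularities.ResolutionOfSingularities.Theorems.RadicialJungCleanModelsCriticalLocusCoordinates
import Summits.ResolutionOfSingularities.ResolutionOfSingularities.Theorems.RadicialJungCleanModelsRegularTypeDerivations
import Literature.AlgebraicGeometry.Resolution.RegularFormallySmoothPrimeField
import Mathlib.RingTheory.Localization.LocalizationLocalization
import HarnessLib

/-!
# Giraud's critical locus `E(f)` is closed on a regular affine scheme of finite type over any field

Route `ResolutionOfSingularities/RadicialJung`, crux `CleanModels` (stmt-ResolutionOfSingularities-15917),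
line `via-clean-models` of crux `DescentPerfectToAll` (stmt-ResolutionOfSingularities-0549): brick
K3b-iv of PROGRAMME-clean-dim2 (Giraud's normal form over an ARBITRARY ground field). Helper file
(`--supports`), OURS; nothing here is a statement of Hironaka's manuscript.

For `A` of finite type over a field `k` of characteristic `p` — `k` ARBITRARY, in particular not
necessarily `F`-finite — all of whose local rings are regular, and `f ∈ A`, the set
`E(f) = {𝔮 ∈ Spec A : f ∈ A_𝔮^p + 𝔮²A_𝔮}` (Giraud 1983, Déf. 1.2, read without `Ω¹`: at a regular
point `f ∈ A_𝔮^p + 𝔮²A_𝔮` iff every derivation of `A_𝔮` maps `f` into `𝔮A_𝔮`, the tree's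
`forall_derivation_apply_mem_iff_exists_sub_pow_mem_sq`) is CLOSED in `Spec A`
(`isClosed_setOf_exists_sub_pow_mem_sq_of_isRegular`). Assembly of the tree's bricks: regular local
rings essentially of finite type over a field are formally smooth over `𝔽_p`
(`formallySmooth_zmod_of_isRegularLocalRing_of_essFiniteType`), so `Ω[A_𝔮⁄ℤ]` (`= Ω[A_𝔮⁄𝔽_p]`) is
projective (`projective_kaehler_int_of_zmod`); hence `Ω[A_r⁄ℤ]` is free on a basic open
neighbourhood `D(r)` of `𝔮` (`exists_free_kaehler_localization_away`); there `E` is the zero locus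
of the coordinates of `df` (`forall_derivation_apply_mem_iff_forall_repr_mem`), transported along
`Spec A_r ≅ D(r)` and `(A_r)_𝔮' ≅ A_𝔮`. This is Giraud's "`Sing(X, df)` est un fermé de dimension
zéro" (2.2 (3)) — the closedness half — with the standing hypothesis "`Ω¹_X` of finite rank" (1.1)
removed.

## References
* J. Giraud, *Forme normale d'une fonction sur une surface de caractéristique positive*, Bull. Soc.
  Math. France 111 (1983), 1.1, Déf. 1.2, 2.2 (3). [Giraud1983]
* The Stacks Project, Tags 031I, 07PE. [StacksProject]
-/

noncomputable section

set_option linter.dupNamespace false -- mandated namespace of this single-conjunct summit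

open KaehlerDifferential Module IsLocalRing
open Literature.AlgebraicGeometry.Resolution

namespace Summit.ResolutionOfSingularities.ResolutionOfSingularities.Theorems.RadicialJung.CleanModels

universe u

/-! ## Transport lemmas -/

/-- Isomorphisms of local rings map `𝔪²` into `𝔪²`. [folklore] -/
theorem ringEquiv_apply_mem_sq_maximalIdeal {P P' : Type*} [CommRing P] [CommRing P'] [IsLocalRing P]
    [IsLocalRing P'] (ε : P ≃+* P') {y : P} (hy : y ∈ maximalIdeal P ^ 2) :
    ε y ∈ maximalIdeal P' ^ 2 := by
  have := Ideal.mem_map_of_mem ε hy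
  rwa [Ideal.map_pow, IsLocalRing.map_ringEquiv_maximalIdeal] at this

/-- The condition «`x - g^n ∈ 𝔪²` for some `g`» (`x ∈ O^n + 𝔪²`) transports along isomorphisms of
local rings. [folklore] -/
theorem exists_sub_pow_mem_sq_iff_of_ringEquiv {O O' : Type*} [CommRing O] [CommRing O']
    [IsLocalRing O] [IsLocalRing O'] (e : O ≃+* O') (n : ℕ) (x : O) :
    (∃ g : O, x - g ^ n ∈ maximalIdeal O ^ 2) ↔ ∃ g' : O', e x - g' ^ n ∈ maximalIdeal O' ^ 2 := by
  constructor
  · rintro ⟨g, hg⟩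
    refine ⟨e g, ?_⟩
    have := ringEquiv_apply_mem_sq_maximalIdeal e hg
    rwa [map_sub, map_pow] at this
  · rintro ⟨g', hg'⟩
    refine ⟨e.symm g', ?_⟩
    have := ringEquiv_apply_mem_sq_maximalIdeal e.symm hg'
    rwa [map_sub, map_pow, RingEquiv.symm_apply_apply] at this

/-- `Ω[O⁄ℤ]` is projective as soon as `Ω[O⁄𝔽_p]` is (the two agree: `d` kills the image of `𝔽_p`);
proved as a split injection `Ω[O⁄ℤ] → Ω[O⁄𝔽_p] → Ω[O⁄ℤ]`. [folklore] -/
theorem projective_kaehler_int_of_zmod (p : ℕ) {O : Type u} [CommRing O] [Algebra (ZMod p) O]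
    [Module.Projective O Ω[O⁄ZMod p]] : Module.Projective O Ω[O⁄ℤ] := by
  obtain ⟨δ, hδ⟩ := exists_derivation_zmod_of_int p (D ℤ O)
  let s : Ω[O⁄ZMod p] →ₗ[O] Ω[O⁄ℤ] := δ.liftKaehlerDifferential
  let i : Ω[O⁄ℤ] →ₗ[O] Ω[O⁄ZMod p] := map ℤ (ZMod p) O O
  refine Module.Projective.of_split i s ?_
  refine Derivation.liftKaehlerDifferential_unique _ _ ?_
  ext x
  change s (i (D ℤ O x)) = D ℤ O x
  rw [KaehlerDifferential.map_D, Derivation.liftKaehlerDifferential_comp_D, hδ]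
  rfl

/-- The type `Ω[S⁄ℤ]`, and its projectivity, do not depend on the `ℤ`-algebra structure used to form
it (there is only one, `int_algebra_subsingleton`; but e.g. `Localization`'s instance is not
definitionally the generic one). [folklore] -/
theorem projective_kaehler_int_congr {S : Type u} [CommRing S] (i₁ i₂ : Algebra ℤ S)
    (h : by letI := i₁; exact Module.Projective S Ω[S⁄ℤ]) :
    by letI := i₂; exact Module.Projective S Ω[S⁄ℤ] := by
  obtain rfl : i₁ = i₂ := Subsingleton.elim _ _
  exact h

/-- The same for freeness. [folklore] -/
theorem free_kaehler_int_congr {S : Type u} [CommRing S] (i₁ i₂ : Algebra ℤ S)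
    (h : by letI := i₁; exact Module.Free S Ω[S⁄ℤ]) :
    by letI := i₂; exact Module.Free S Ω[S⁄ℤ] := by
  obtain rfl : i₁ = i₂ := Subsingleton.elim _ _
  exact h

/-! ## The closed critical locus -/

/-- **Giraud's `E(f)` is closed on `Spec A` for `A` regular of finite type over ANY field of
characteristic `p`**: for `f ∈ A`, the set of primes `𝔮` with `f ∈ A_𝔮^p + 𝔮²A_𝔮` is closed.
[cite: Giraud1983, Déf. 1.2, 2.2 (3)] [cite: StacksProject, Tag 031I] -/
theorem isClosed_setOf_exists_sub_pow_mem_sq_of_isRegular (p : ℕ) [Fact p.Prime] (k A : Type)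
    [Field k] [CharP k p] [CommRing A] [Algebra k A] [Algebra.FiniteType k A]
    (hreg : ∀ Q : PrimeSpectrum A, IsRegularLocalRing (Localization.AtPrime Q.asIdeal)) (f : A) :
    IsClosed {Q : PrimeSpectrum A | ∃ g : Localization.AtPrime Q.asIdeal,
        algebraMap A (Localization.AtPrime Q.asIdeal) f - g ^ p ∈
          maximalIdeal (Localization.AtPrime Q.asIdeal) ^ 2} := by
  classical
  rw [← isOpen_compl_iff, isOpen_iff_forall_mem_open]
  intro Q₀ hQ₀
  -- `Ω[A_{𝔮₀}⁄ℤ]` is projective: `A_{𝔮₀}` is regular, essentially of finite type over `k`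
  let L₀ := Localization.AtPrime Q₀.asIdeal
  haveI : IsRegularLocalRing L₀ := hreg Q₀
  haveI : CharP L₀ p := charP_of_injective_algebraMap (algebraMap k L₀).injective p
  have hproj : Module.Projective L₀ Ω[L₀⁄ℤ] := by
    letI : Algebra (ZMod p) L₀ := ZMod.algebra L₀ p
    haveI := formallySmooth_zmod_of_isRegularLocalRing_of_essFiniteType p k L₀
    exact projective_kaehler_int_congr _ _ (projective_kaehler_int_of_zmod p (O := L₀))
  -- hence `Ω[A_r⁄ℤ]` is free for some `r ∉ 𝔮₀`
  obtain ⟨r, hr, hfree⟩ := exists_free_kaehler_localization_away ℤ k A Q₀.asIdeal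
  let B := Localization.Away r
  have hfree' : (by letI := Ring.toIntAlgebra B; exact Module.Free B Ω[B⁄ℤ]) :=
    free_kaehler_int_congr _ (Ring.toIntAlgebra B) hfree
  let b := by letI := Ring.toIntAlgebra B; exact @Module.Free.chooseBasis B Ω[B⁄ℤ] _ _ _ hfree'
  have hemb : Topology.IsOpenEmbedding (PrimeSpectrum.comap (algebraMap A B)) :=
    PrimeSpectrum.localization_away_isOpenEmbedding B r
  -- on `Spec B = D(r)` the locus is the zero locus of the coordinates of `d(f/1)`
  let C : Set (PrimeSpectrum B) :=
    {Q' : PrimeSpectrum B |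
      ∀ i, b.repr (by letI := Ring.toIntAlgebra B; exact KaehlerDifferential.D ℤ B (algebraMap A B f)) i
        ∈ Q'.asIdeal}
  have hC : IsClosed C := isClosed_setOf_forall_repr_mem b (algebraMap A B f)
  -- transport of the condition along `(A_r)_{𝔮'} ≅ A_{𝔮' ∩ A}`
  have key : ∀ Q' : PrimeSpectrum B,
      (∃ g : Localization.AtPrime (Ideal.comap (algebraMap A B) Q'.asIdeal),
        algebraMap A _ f - g ^ p ∈ maximalIdeal _ ^ 2) ↔ Q' ∈ C := by
    intro Q'
    let L' := Localization.AtPrime Q'.asIdeal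
    let e := IsLocalization.localizationLocalizationAtPrimeIsoLocalization
      (Submonoid.powers r) Q'.asIdeal
    -- `L'` is a regular local ring essentially of finite type over `k`
    haveI : IsRegularLocalRing (Localization.AtPrime (Ideal.comap (algebraMap A B) Q'.asIdeal)) :=
      hreg (PrimeSpectrum.comap (algebraMap A B) Q')
    haveI : IsRegularLocalRing L' := IsRegularLocalRing.of_ringEquiv e.toRingEquiv
    haveI : CharP L' p := charP_of_injective_algebraMap (algebraMap k L').injective p
    letI : Algebra (ZMod p) L' := ZMod.algebra L' p
    haveI := formallySmooth_zmod_of_isRegularLocalRing_of_essFiniteType p k L'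
    refine (exists_sub_pow_mem_sq_iff_of_ringEquiv e.toRingEquiv p _).trans ?_
    have hef : e.toRingEquiv
        (algebraMap A (Localization.AtPrime (Ideal.comap (algebraMap A B) Q'.asIdeal)) f) =
        algebraMap B L' (algebraMap A B f) := by
      change e _ = _
      rw [AlgEquiv.commutes, IsScalarTower.algebraMap_apply A B L']
    rw [hef, ← forall_derivation_apply_mem_iff_exists_sub_pow_mem_sq p (algebraMap B L' (algebraMap A B f))]
    exact forall_derivation_apply_mem_iff_forall_repr_mem b (algebraMap A B f) Q'.asIdeal L'
  -- the open neighbourhood `comap '' Cᶜ` of `𝔮₀` avoids `E`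
  obtain ⟨Q₀', hQ₀'⟩ : Q₀ ∈ Set.range (PrimeSpectrum.comap (algebraMap A B)) := by
    rw [PrimeSpectrum.localization_away_comap_range B r]
    exact hr
  refine ⟨PrimeSpectrum.comap (algebraMap A B) '' Cᶜ, ?_, hemb.isOpenMap _ hC.isOpen_compl, ?_⟩
  · rintro _ ⟨Q', hQ', rfl⟩ hmem
    exact hQ' ((key Q').mp hmem)
  · refine ⟨Q₀', fun hmem => hQ₀ ?_, hQ₀'⟩
    rw [← hQ₀']
    exact (key Q₀').mpr hmem

end Summit.ResolutionOfSingularities.ResolutionOfSingularities.Theorems.RadicialJung.CleanModels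

end
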